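import Summits.BirchSwinnertonDyer.Rank1Residual.Additive.FouquetWanLocus
import Literature.NumberTheory.DiophantineGeometry.TateAlgorithm
import HarnessLib

/-!
# Fouquet–Wan POINT transport at a wild `3`: the ADDITIVE non-split witness (Kodaira `IV`/`IV*` at
# `q ≠ 3`), its census-decidable `μ`-law, and the claim SHAPE over the interface `KMC`
# (cell `b2b-bsdres`, lane CLASS-CLOSURE, class O6, seat o6-r1 GEN 9 — freeze for cc-typer-5; NOTHING ASSERTED)

HONEST FRAMING (cell `b2b-bsdres`, run/shared/lean/b2b/bsd-rank1-residual/, verbatim in every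
file): the goal of the cell is to DELETE the COMBINATION-SHAPED residual classes of the
Birch–Swinnerton-Dyer formula for ALL analytic-rank `≤ 1` elliptic curves over `ℚ` — "full BSD
formula for every rank `≤ 1` curve in class `C`" assembled STRICTLY from published theorems — so
that the rank-`≤ 1` remainder becomes exactly the CONSTRUCTION-SHAPED classes, which are TYPED
(missing-input `Prop`s), NOT attempted. This is not "finishing BSD". Lane CLASS-CLOSURE
(`CLASS-CLOSURE-PLAN.md` §3.4 O6, experiment type (2) OBSTRUCTION ANATOMY → SUB-PARTITION: "take the
neighbouring proof and census EXACTLY which hypothesis fails on which pairs"): research routes; no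
claim beyond the stated classes; census output is EVIDENCE, never a Literature fact; nothing is
booked; no mark of `RESIDUAL-MAP.md` moves. NO Literature fact is minted here and NO `_OPEN` cited
Prop is registered: this file is the sequel of `Additive/FouquetWanLocus.lean` (cc-typer-5 GEN 4) and
types (i) a SECOND census-decidable witness of the third hypothesis of the neighbouring ANNOUNCED proof
— an ADDITIVE prime `q ≠ 3` of Kodaira type `IV`/`IV*` whose unramified quadratic character `μ_q` is
non-trivial — together with the elementary LOCAL law that decides `μ_q` from `(c_q, q mod 3)`, (ii) the
local `3`-torsion statement behind that law as a TARGET (theorem-candidate, not asserted), and (iii) the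
conclusion of the announced proof READ AT THE POINT `f_E` as a hypothesis SHAPE over the SAME interface
`KMC` (Kato's main conjecture Conj. 12.10 at `(f_E, 3)`, definition request D-O6-2) — so that a second
NAMED sub-class of the wild residue R-O6-5′ has kernel consequences, and its complement is handed on.

## What the announced proof says AT A POINT (PRE — unrefereed preprint; a CLAIM, not a theorem of record)

O. Fouquet, X. Wan, *The Iwasawa Main Conjecture for modular motives*, arXiv:2107.13726v3
[FouquetWan2021] (held text, pages = PDF pages). **Theorem 1.7** (p. 5) = Thm. 5.1 (p. 53) for
`f ∈ S_k(Γ₀(N))`: three hypotheses on `ρ̄ = ρ̄_f` ONLY — `ρ̄` absolutely irreducible; no character `χ̄`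
of `G_{ℚ_p}` with `(ρ̄|G_{ℚ_p})^{ss} = χ̄ ⊕ χ̄_cyc χ̄`; "there exists `ℓ ∤ p` such that `ρ̄|G_{ℚ_ℓ}` is a
ramified extension `0 → μχ_cyc^{1−k/2} → ρ̄|G_{ℚ_ℓ} → μχ_cyc^{−k/2} → 0` where `μ : G_{ℚ_ℓ} → {±1}` is
the non-trivial unramified quadratic character" — and the conclusion "If `ℓ ∥ N`, then the Iwasawa Main
Conjecture holds for `M(f)`". The printed remark right after it (p. 5), verbatim: *"the three main
hypotheses of theorem 1.7 are requirements solely on `ρ̄_f` … This means that the conclusion of the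
theorem may be replaced by the statement that the Iwasawa Main Conjecture holds for all eigencuspforms
of level `Γ₀` which are points of a suitably defined universal deformation ring."* **Theorem 1.8**
(p. 6): under the hypotheses of Thm. 1.7 on `ρ̄`, the universal zeta morphism is an isomorphism
`Δ_Σ(T_Σ) ≅ 𝕋^Σ_{𝔪_ρ̄}` (Kato's generalised main conjecture for the universal family), where
`𝕋^Σ_{𝔪_ρ̄}` (§2.1, p. 12) is the local factor at `𝔪_ρ̄` of the Hecke algebra of level `U = U_p U^p`
with `U` ARBITRARILY SMALL at `Σ` ("allowable and sufficiently small", p. 12) — so EVERY eigencuspform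
`g` with `ρ̄_g ≅ ρ̄` ramified inside `Σ`, of any local type at the primes of `Σ`, is a classical point of
it. **Proposition 5.8** (p. 55), verbatim: *"Assume that there is an isomorphism
`triv_Σ : Δ_Σ(T_Σ) ≅ 𝕋^Σ_{𝔪_ρ̄}` … Let `λ(f) : 𝕋^Σ_{𝔪_ρ̄} → O` be a classical point. Then … conjecture
(ConjIMC) is true for `λ(f)`"* (proof: Kato's divisibility Thm. 12.5 at `f` + Prop. 3.23 + Prop. 3.10:
a classical point is relatively pure, hence Iwasawa-suitable). READING (o6-r1 GEN 9; a question for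
the literature seat, not a fact): Thm. 1.8 + Prop. 5.8 give (ConjIMC), i.e. Kato's Conj. 12.10 in
characteristic-ideal form, for `f = f_E` whenever `ρ̄ = E[3]` satisfies the three hypotheses — with NO
condition `ℓ ∥ N_E`: the witness prime `ℓ` may be a prime of ADDITIVE reduction of `E` (`ℓ² ∣ N_E`),
because the hypotheses see only `ρ̄|G_{ℚ_ℓ}`. TENSION recorded honestly: (a) Thms. 1.7/5.1 themselves
carry "If `ℓ ∥ N`"; (b) Assumption 3.7 (p. 20: "There exists `ℓ ∥ N`, `ℓ ≠ p` such that
`dim ρ̄_f^{I_ℓ} = 1`", an assumption on `𝔪_ρ̄`) is USED only on p. 21 to get `p ∣ #ρ̄(G_ℚ)` — automatic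
here, since `ρ̄(I_q)` is a non-trivial unipotent group of order `3`; (c) the p. 6 hedge "(ConjIMCweak)
is true except possibly on a closed subset of positive codimension" concerns a WEAKER intermediate
statement; (d) the `f_E`-type points (inertia of order `3` at `q`, `q² ∥ N`) and the Steinberg points
(`q ∥ N`) lie on different irreducible components of `Spec 𝕋^Σ_{𝔪_ρ̄}`, and the propagation
Props. 5.5–5.7 is internal to the proof of Thm. 1.8 — so the transport is NOT "IMC of one level-lowered
companion ⟹ IMC of `f_E`" (gen 8's LL-b as drawn is withdrawn as a mechanism; the companion survives
as EVIDENCE and as the reading `a_q(g) = μ_q(Frob_q)` below).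

## The additive witness and the `μ`-law (local lemma; theorem-level mathematics, typed as a TARGET)

Let `E/ℚ` have Kodaira type `IV` or `IV*` at a prime `q ≠ 3` (additive, potentially good, `Φ_q(𝔽̄_q)
≅ ℤ/3`, `c_q ∈ {1, 3}`). Then `ρ̄ = E[3]` restricted to `I_q` acts through the order-`3` quotient of
inertia by a NON-TRIVIAL UNIPOTENT (an element of order `3` of `GL₂(𝔽₃)` is unipotent), so
`E[3]^{I_q}` is a line (`d_q = 1`, `n_q(ρ̄) = 1`; gen 8 `Additive/InertiaTraceComponentOrder.lean`) and
`E[3]|G_{ℚ_q} ≅ (μχ̄_cyc ∗ ; 0 μ)` RAMIFIED with `μ` unramified quadratic — EXACTLY the third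
hypothesis' shape, split (`μ = 1`) or non-split (`μ ≠ 1`). `Frob_q` acts on the line `E[3]^{I_q} =
E[3](ℚ_q^{nr})` by `μ(Frob_q)·q`. On the other side `E₀(ℚ_q)` is uniquely `3`-divisible with no
`3`-torsion (`E₁` pro-`q`, `Ẽ_ns(𝔽_q) = 𝔾_a(𝔽_q)`), so `E(ℚ_q)[3] ≅ Φ_q(𝔽_q)[3]`, i.e.
**`E(ℚ_q)` has a point of order `3` iff `c_q = 3`** (`LocalThreeTorsionIffTamagawaThreeOfIV`, TARGET — a THEOREM
since 2026-08-21: `localThreeTorsionIffTamagawaThreeOfIV_holds`, x11b3-p4 GEN 9 p304213, see its docstring).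
Combining: `c_q = 3 ⟺ μ(Frob_q)·q ≡ 1 (mod 3)`, hence the **`μ`-law**
`μ_q = −1 (non-split) ⟺ ([c_q = 3] ⟺ [q ≡ 2 (mod 3)])` — census-decidable from `(Kodaira type, c_q, q
mod 3)`; equivalently the level-lowered newform `g` of level `N/q` (Steinberg at `q`, `ρ̄_g ≅ ρ̄`) has
`a_q(g) = μ_q`. NOTE the law is special to `p = 3` (for `p ≥ 5` a type-`IV`/`IV*` inertia acts
semisimply on `E[p]` with no fixed line); it holds at EVERY `q ≠ 3` including `q = 2`, where Kodaira
`IV`/`IV*` forces `#E[3]^{I₂} = #Φ₂[3] = 3` by the Néron model and hence a tame order-`3` unipotent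
inertia image on `E[3]` even when `E` is wildly ramified at `2`.
EVIDENCE (o6-r1 GEN 9, `HOME/b2b-bsdres-o6-r1/gen9/fwmu/mu_test.py`, `mu_test_q2.py`, on gen 8's V8-LL
matched pairs `(W, G)`, `G` a rational companion with `ρ̄_G ≅ ρ̄_W`, multiplicative at the `IV`/`IV*`
prime `q` of `W`, `3 ∤ v_q(Δ_G)`, so that `μ_q = +1 ⟺ G split at q`; split test `−c₆(G) ∈ (𝔽_q^×)²` for
`q ≥ 5`, `#Ẽ_ns(𝔽₂) = 1` for `q = 2`): **`q ≥ 5`: 28 306 / 28 306 pairs agree, 0 disagree** (8 083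
distinct `(W, q)`; `q ≡ 1, c_q = 1`: non-split 5 468; `q ≡ 1, c_q = 3`: split 5 050; `q ≡ 2, c_q = 1`:
split 9 436; `q ≡ 2, c_q = 3`: non-split 8 352); **`q = 2`: 33 318 / 33 318 agree, 0 disagree** (10 599
distinct `W`; `c₂ = 1`: split 17 892; `c₂ = 3`: non-split 15 426).

CENSUS of the enlarged locus (EVIDENCE, o6-r1 GEN 9, engine `fwplus_census.py`, universe `U` = the
154 058 wild-at-`3` isogeny-class representatives with `ρ̄_{E,3}` surjective, `N < 500 000`; `LocIrr W 3`
by the `ψ₃`-root test, validated 26 015 / 26 015 against rmap-2 gen 8; rows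
`HOME/b2b-bsdres-o6-r1/gen9/fwmu/fwplus_rows.tsv.gz`): `LocIrr` holds ONLY at `v₃(N) = 3` (23 919 /
107 465; 0 / 46 593 at `v₃(N) ∈ {4,5}`). FW-old := `LocIrr ∧ FWNonsplitRam`: 15 736 classes; FW⁺ :=
`LocIrr ∧ (FWNonsplitRam ∨ ∃ q, FWNonsplitAddThree)`: 16 442 (+706). On the wild RESIDUE R-O6-5′
(wild ∧ towerSurj ∧ ≥ 2 additive Tamagawa-`3` places; 2 073 classes, r0 552 / r1 1 521; by `v₃(N)`:
1 528 / 385 / 160 at `3 / 4 / 5`): `LocIrr` 421 (r0 120 / r1 301, all `v₃(N) = 3`); FW-old 185 (45 / 140);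
**FW⁺ 356 (96 / 260), increment 171 (51 / 120)** (e.g. 17388n1, 18252j1, 18900ba1, 25650cm1, 43200kh1,
78300bt1, 99981t1); `LocIrr ∖ FW⁺` = 65 classes (every `IV`/`IV*` prime split and no non-split Tate
prime). Outside R-O6-5′ the increment is 234 / 301 further `towerSurj` classes. The `LocIrr` cap
(`v₃(N) = 3` only; 1 652 of the 2 073 residue classes fail it) is untouched by this file.

Contents: §1 the predicates `HasKodairaIVOrIVstarAt`, `FWNonsplitAddThree` and their decidable
reading by `q mod 3`; §2 the local TARGET `LocalThreeTorsionIffTamagawaThreeOfIV`; §3 the point claim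
SHAPE `FouquetWanPointClaimShape KMC` (consumed only explicitly) and its comparison with
`FouquetWanClaimShape`; §4 kernel consequences on O6 at `3` (rank `0`: `MissingPPartAt W 3` from the
shape + the shared descent shell + Kato's published upper half, exactly as in `FouquetWanLocus` §3).

## TYPER PLACEMENT NOTE (cc-typer-5 GEN 5, typer of record O5 §3.5 / O6 §3.4, 2026-08-21)
Landed VERBATIM from o6-r1 GEN 9's freeze `HOME/b2b-bsdres-o6-r1/gen9/lean/FouquetWanPointTransport.lean`
(sha16 e028607154874b58, 279 lines; ASK A-O6-T9, INBOX 2026-08-21T14:55Z; farm rc 0 / 0 warnings / 0 sorries)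
below this note. It SUPERSEDES the never-typed LL-b node `LevelLoweredUnitCompanionTransport` (o6-r1 GEN 8 offer
(iii)): no such node will come. Reading of the four `def … : Prop` (audit classes as in `FouquetWanLocus.lean`):
`HasKodairaIVOrIVstarAt W q` and `FWNonsplitAddThree W q` are PREDICATES (definitions with bodies over the tree's
`kodairaSymbolAt` / `localTamagawaNumber`); `LocalThreeTorsionIffTamagawaThreeOfIV` is a closed TARGET statement
(T-O6-μ: a published local lemma, Silverman AEC VII.2.1 / VII.6.1 / Table 15.1, typed for a later kernel proof —
NOT a Literature fact, NOT asserted, consumed nowhere as a hypothesis in this file); `FouquetWanPointClaimShape KMC`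
is a HYPOTHESIS SHAPE over the interface `KMC` exactly like `FouquetWanClaimShape` (an unrefereed preprint's
reading, consumed only as an explicit binder `hFW`). Theorems only otherwise; 0 Literature facts; nothing booked;
no mark of `RESIDUAL-MAP.md` moves.
-/

set_option autoImplicit false

noncomputable section

open scoped Classical

open WeierstrassCurve Literature.NumberTheory.EllipticCurves
  Literature.NumberTheory.EllipticCurves.ModularForms
  Literature.NumberTheory.EllipticCurves.Rank1Residual
  Literature.NumberTheory.EllipticCurves.Rank1Residual.Typed
  Literature.NumberTheory.DiophantineGeometry

namespace Summit.BirchSwinnertonDyer.Rank1Residual.Additive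

/-! ## §1 The additive witness, by name -/

section Witness

variable (W : WeierstrassCurve ℚ) (q : ℕ) [Fact q.Prime]

/-- **Kodaira type `IV` or `IV*` at `q`**: the special fibre of the minimal regular model of `W` at the
place of `q` has Kodaira symbol `IV` or `IV*` (Tate's algorithm, tree `WeierstrassCurve.kodairaSymbolAt`;
census bit: PARI/Cremona Kodaira code `4` / `−4`). These are the additive potentially-good types with
geometric component group `ℤ/3`. [cite: SilvermanAEC2009, Table 15.1 (App. C)] -/
def HasKodairaIVOrIVstarAt : Prop :=
  W.kodairaSymbolAt (placeOf q) = .IV ∨ W.kodairaSymbolAt (placeOf q) = .IVstar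

/-- **(Add⁻), the ADDITIVE non-split witness at `p = 3`**: a prime `q ≠ 3` of Kodaira type `IV`/`IV*`
at which the unramified quadratic character `μ_q` of `E[3]|G_{ℚ_q} ≅ (μχ̄_cyc ∗ ; 0 μ)` is NON-TRIVIAL,
written through the `μ`-law `μ_q = −1 ⟺ ([c_q = 3] ⟺ [q ≡ 2 (mod 3)])` (module docstring; local
Tamagawa number `c_q` = tree `localTamagawaNumber` over `ℤ_q`). Census-decidable from Cremona's
`(Kodaira type, c_q)` at `q`. On the `LocIrr W 3` branch this is a second instance of Fouquet–Wan's
third hypothesis (the first being `FWNonsplitRam W 3`). [cite: FouquetWan2021, Thm. 1.7 (p. 5)] -/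
def FWNonsplitAddThree : Prop :=
  q ≠ 3 ∧ HasKodairaIVOrIVstarAt W q ∧
    ((W.baseChange ℚ_[q]).localTamagawaNumber ℤ_[q] = 3 ↔ q % 3 = 2)

/-- The witness read at `q ≡ 2 (mod 3)`: non-split iff `c_q = 3`. [folklore] -/
theorem fwNonsplitAddThree_iff_of_mod_eq_two (hq : q % 3 = 2) :
    FWNonsplitAddThree W q ↔
      HasKodairaIVOrIVstarAt W q ∧ (W.baseChange ℚ_[q]).localTamagawaNumber ℤ_[q] = 3 := by
  have hq3 : q ≠ 3 := by rintro rfl; simp at hq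
  simp [FWNonsplitAddThree, hq, hq3]

/-- The witness read at `q ≡ 1 (mod 3)`: non-split iff `c_q ≠ 3` (i.e. `c_q = 1`). [folklore] -/
theorem fwNonsplitAddThree_iff_of_mod_eq_one (hq : q % 3 = 1) :
    FWNonsplitAddThree W q ↔
      HasKodairaIVOrIVstarAt W q ∧ (W.baseChange ℚ_[q]).localTamagawaNumber ℤ_[q] ≠ 3 := by
  have hq3 : q ≠ 3 := by rintro rfl; simp at hq
  have hq2 : ¬ q % 3 = 2 := by rw [hq]; decide
  simp [FWNonsplitAddThree, hq3, hq2]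

/-- No witness at `q = 3` itself (the law and the hypothesis concern `ℓ ≠ p`). [folklore] -/
theorem not_fwNonsplitAddThree_three (W : WeierstrassCurve ℚ) :
    ¬ FWNonsplitAddThree W 3 := fun h => h.1 rfl

end Witness

/-! ## §2 The local `3`-torsion law at a type-`IV`/`IV*` prime (TARGET; theorem-candidate, not asserted) -/

section LocalLaw

/-- **TARGET T-O6-μ (local lemma behind the `μ`-law).** For `W/ℚ` globally minimal and elliptic with
Kodaira type `IV` or `IV*` at a prime `q ≠ 3`: `E(ℚ_q)` has a point of order `3` iff `c_q = 3`.
Proof sketch (in print, elementary): `E(ℚ_q)/E₀(ℚ_q) ≅ Φ_q(𝔽_q)` of order `c_q ∈ {1,3}`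
(`Φ_q(𝔽̄_q) ≅ ℤ/3`), and `E₀(ℚ_q)` is uniquely `3`-divisible without `3`-torsion because `E₁(ℚ_q)` is
pro-`q` and `E₀/E₁ ≅ Ẽ_ns(𝔽_q) ≅ 𝔽_q` (additive reduction), `q ≠ 3`; so `E(ℚ_q)[3] ≅ Φ_q(𝔽_q)[3]`.
Galois reading (module docstring): `E(ℚ_q)[3] ≠ 0 ⟺ μ_q(Frob_q)·q ≡ 1 (mod 3)`, which turns this
target into the census `μ`-law (EVIDENCE 28 306 / 0). Typed over local points of the base change;
nothing asserted. **PROVED 2026-08-21 (cc-typer-5 GEN 10 restamp): `localThreeTorsionIffTamagawaThreeOfIV_holds :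
LocalThreeTorsionIffTamagawaThreeOfIV`** (cross-cell pool hand x11b3-p4 GEN 9,
`Additive/LocalThreeTorsionIffTamagawaThreeOfIVHolds.lean` p304213 62554ee9ab86, with the field-general local-analysis
file `Additive/AdditiveReductionPrimeToPDivisible.lean` p303746: at an additive place with residue characteristic
`∤ n`, `E₀(K)` is uniquely `n`-divisible with no `n`-torsion — `E₁` pro-`q` via the formal group, `E₀/E₁ ≅ (k, +)` —
so `E(K)[3] ≅ Φ(k)[3]`, and `#Φ(𝔽_q) = c_q ∈ {1, 3}` at IV / IV* by the tree's Tate algorithm); binders verbatim (any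
`q ≠ 3`, any wildness at `q = 2`); this lane's first refusal: no objection. Statement byte-identical; the census `μ`-law
stays EVIDENCE; nothing booked; no mark. [cite: SilvermanAEC2009, Prop. VII.2.1, Thm. VII.6.1 and Table 15.1] -/
def LocalThreeTorsionIffTamagawaThreeOfIV : Prop :=
  ∀ (W : WeierstrassCurve ℚ) [W.IsElliptic] (q : ℕ) [Fact q.Prime], q ≠ 3 →
    HasKodairaIVOrIVstarAt W q →
      ((∃ P : (W.baseChange ℚ_[q]).toAffine.Point, P ≠ 0 ∧ (3 : ℕ) • P = 0) ↔
        (W.baseChange ℚ_[q]).localTamagawaNumber ℤ_[q] = 3)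

end LocalLaw

/-! ## §3 The claim SHAPE at the point `f_E` (a hypothesis shape over the interface `KMC`; consumed only explicitly) -/

section Claim

variable (KMC : ∀ (W : WeierstrassCurve ℚ) [W.IsElliptic] [W.IsGloballyMinimal] (p : ℕ), Prop)

/-- **SHAPE of Fouquet–Wan Thm. 1.8 + Prop. 5.8 READ AT THE POINT `f_E`, `p = 3`** (o6-r1 GEN 9 reading
of an unrefereed preprint; NOT a theorem of record, NOT a Literature fact; a question for the
literature seat is recorded in the module docstring under TENSION): for `W/ℚ` globally minimal and
elliptic with `ρ̄_{E,3}(G_ℚ) ⊇ SL₂(𝔽₃)` (absolute irreducibility, also over `ℚ(ζ₃)`), `E[3]|G_{ℚ₃}`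
irreducible (`LocIrr W 3` — at `3`, for elliptic curves, EQUIVALENT to the second hypothesis), and a
NON-SPLIT ramified witness prime `q ≠ 3` — multiplicative (`FWNonsplitRam W 3`) OR additive of type
`IV`/`IV*` (`FWNonsplitAddThree W q`) — Kato's main conjecture holds at `(f_E, 3)`. Over the interface
`KMC` (D-O6-2). Nothing asserted; consumed only as an explicit hypothesis `(hFW : …)`.
[cite: FouquetWan2021, Thm. 1.8 (p. 6), Prop. 5.8 (p. 55), remark after Thm. 1.7 (p. 5)] -/
def FouquetWanPointClaimShape : Prop :=
  ∀ (W : WeierstrassCurve ℚ) [W.IsElliptic] [W.IsGloballyMinimal],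
    Kato2004.ImageContainsSL2 W 3 → LocIrr W 3 →
    (FWNonsplitRam W 3 ∨ ∃ (q : ℕ) (_ : Fact q.Prime), FWNonsplitAddThree W q) → KMC W 3

/-- **The point shape contains the Thm. 5.1 shape on the big-image rows at `3`**: a `FWNonsplitRam`
witness is the left disjunct. (The converse containment fails by design: the additive witness is new.)
[folklore] -/
theorem kmc_three_of_fwPointClaim_of_fwNonsplitRam (hFW : FouquetWanPointClaimShape KMC)
    (W : WeierstrassCurve ℚ) [W.IsElliptic] [W.IsGloballyMinimal]
    (himg : Kato2004.ImageContainsSL2 W 3) (hirr : LocIrr W 3) (hstb : FWNonsplitRam W 3) :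
    KMC W 3 :=
  hFW W himg hirr (Or.inl hstb)

/-- **The new rows**: an additive non-split witness `q` gives `KMC W 3` under the point shape.
[folklore] -/
theorem kmc_three_of_fwPointClaim_of_fwNonsplitAddThree (hFW : FouquetWanPointClaimShape KMC)
    (W : WeierstrassCurve ℚ) [W.IsElliptic] [W.IsGloballyMinimal]
    (himg : Kato2004.ImageContainsSL2 W 3) (hirr : LocIrr W 3)
    (q : ℕ) [Fact q.Prime] (hadd : FWNonsplitAddThree W q) : KMC W 3 :=
  hFW W himg hirr (Or.inr ⟨q, ‹Fact q.Prime›, hadd⟩)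

end Claim

/-! ## §4 Kernel consequences on O6 at `p = 3` (everything conjectural or announced is a hypothesis) -/

section Consequences

variable (KMC : ∀ (W : WeierstrassCurve ℚ) [W.IsElliptic] [W.IsGloballyMinimal] (p : ℕ), Prop)

/-- **Inside the enlarged locus, the shared descent shell gives the r0 LOWER half.** For an O5/O6 pair
at `3` with big image, `E[3]|G_{ℚ₃}` irreducible and a non-split witness prime (multiplicative or of
type `IV`/`IV*`), `L(E,1) ≠ 0` and `Ш` finite: `FouquetWanPointClaimShape KMC` (announced, read at the
point) + `O5.PotSupersingularLowerHalfRankZeroOfKMC KMC` (conjecture shell T-O6-A (A0)) ⇒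
`MissingLowerBoundAt W 3`. Nothing credited. [cite: FouquetWan2021, Thm. 1.8 (p. 6), Prop. 5.8 (p. 55)]
[cite: Kato2004Asterisque, Conj. 12.10 (p. 224)] -/
theorem missingLowerBoundAt_three_of_fwPointClaim_of_shared (hFW : FouquetWanPointClaimShape KMC)
    (hshared : O5.PotSupersingularLowerHalfRankZeroOfKMC KMC)
    (W : WeierstrassCurve ℚ) [W.IsElliptic] [W.IsGloballyMinimal]
    (hO : ClassO5 W 3 ∨ ClassO6 W 3) (hirr : LocIrr W 3)
    (hwit : FWNonsplitRam W 3 ∨ ∃ (q : ℕ) (_ : Fact q.Prime), FWNonsplitAddThree W q)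
    (himg : Kato2004.ImageContainsSL2 W 3)
    (hL : W.entireLFunction 1 ≠ 0) (hfin : Finite W.sha) : MissingLowerBoundAt W 3 :=
  hshared W hO himg (hFW W himg hirr hwit) hL hfin

/-- **Inside the enlarged locus, rank `0`: the `3`-part in Miller's currency**, from the point shape +
the shared shell (lower half) + Kato Thm. 14.5 (3) (upper half, PUBLISHED, `hKato`) on
`X4 ∧ O6 ∧ r0 ∧ towerSurj ∧ 3 ∤ ∏ c_ℓ ∧ 3 ∤ c_D` — gen 0's `ClassO6.missingPPartAt_iff_lower_of_kato`.
NOTE: on the residue R-O6-5′ (`≥ 2` additive Tamagawa-`3` places) `3 ∣ ∏ c_ℓ`, so THIS corollary does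
not fire there; the residue's consumer is the unit/Tamagawa-`3` node R-O6-unit@3 (TARGETS.md §O6), which
takes `KMC W 3` as its input — supplied on 356 of its 2 073 classes by the point shape. Nothing credited.
[cite: FouquetWan2021, Thm. 1.8 (p. 6), Prop. 5.8 (p. 55)] [cite: Kato2004Asterisque, Thm. 14.5 (3) (p. 236)]
[cite: Miller2011LMS, Def. 1.1] -/
theorem missingPPartAt_three_rankZero_of_fwPointClaim_of_shared_of_kato
    (hFW : FouquetWanPointClaimShape KMC)
    (hshared : O5.PotSupersingularLowerHalfRankZeroOfKMC KMC)
    (hKato : Kato2004.rankZero_padicValNat_sha_le_of_additive_potGood_of_imageContainsSL2)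
    (hGZK : rank_eq_analyticRank_of_analyticRank_le_one) (hmod : hasEntireLFunction_rat)
    (W : WeierstrassCurve ℚ) [W.IsElliptic] [W.IsGloballyMinimal]
    (hr : W.analyticRank = 0) (hO : ClassO6 W 3) (hX : ClassX4 W 3) (hirr : LocIrr W 3)
    (hwit : FWNonsplitRam W 3 ∨ ∃ (q : ℕ) (_ : Fact q.Prime), FWNonsplitAddThree W q)
    (hsurj : ∀ n : ℕ, W.HasSurjectiveModNGaloisRep (3 ^ n : ℕ)) (htam : ¬ 3 ∣ W.tamagawaProduct)
    {N : ℕ} [NeZero N] (D : ModularParametrizationData W N) (hc : ¬ (3 : ℤ) ∣ D.maninConstant) :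
    MissingPPartAt W 3 := by
  have himg : Kato2004.ImageContainsSL2 W 3 :=
    (Kato2004.imageContainsSL2_iff_forall_hasSurjectiveModNGaloisRep W 3).mpr hsurj
  have hL : W.entireLFunction 1 ≠ 0 := (W.analyticRank_eq_zero_iff_holds (hmod W)).mp hr
  have hfin : Finite W.sha := (hGZK W (hr.le.trans zero_le_one)).2
  have hlow := missingLowerBoundAt_three_of_fwPointClaim_of_shared KMC hFW hshared W (Or.inr hO) hirr
    hwit himg hL hfin
  exact (ClassO6.missingPPartAt_iff_lower_of_kato W 3 hKato hGZK hmod hr hO hX hsurj htam D hc).mpr hlow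

end Consequences

end Summit.BirchSwinnertonDyer.Rank1Residual.Additive

end
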